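import Summits.QuantumFields.BalabanUV.Beta.D1BFx.ProfileWordCount

/-!
# `BalabanUV.Beta.D1BFx.ProfileWordFamilies` — road «BF-x» for binder row D1, slot (K): THE PROFILE WORD-FAMILY LETTER (d1), PART 2 of 2 —
# **THE TWO-LEG BUBBLE AND THE TADPOLE FROM PROFILE LEGS AND DENSITY VERTICES, AND THEIR (5.10) FAMILIES WITH AN n-FREE COARSE RATE**:
# `Decay510 (z ↦ biBubble L₁ (𝒱 μ 0) L₂ (𝒱′ ν z)) (|F|²·(Kᵣ(a)κ₁A)·(Kᵣ(b)κ₂A′)·K_{D,a+b}(ε)·n^{2D−(a+b)}) (ε∕(2D))`, `ε = min σ (2δ)`, `a + b ≤ D − 1`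
# — REPLACING the SUP × MASS family letter `GhostWordFamilies.decay510_biBubbleWord_of_decays_bdd_mass` (g18) wherever the legs' algebraic decay inside the
# block scale and the vertices' per-site density are the currency.

WHY and CONSUMERS: see PART 1 `ProfileWordCount` (OWNER d1-p2 g23 W-g23-12 l.49928: GO, two named consumers — the ghost rests of slot (K) at the tower weight
(GHOST-N8-SPEC (d3)) and PART 24's tt rests (A,B)∕(B,B) (PART24-SPEC-g23 §2 R-AB∕R-BB); gan24-leaf-05 g59 W-1 l.49933 GO).  READING at `D = 4`: two density
vertices after one Abel step each (`A = A′ ≍ n⁻⁴` ghost; `≍ n⁻²` tt) against one singular and one block-smooth leg (`a + b = 2`, `κ₁κ₂ ≍ n⁻⁶`; resp. `a + b = 3`,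
Coulomb gradient × smooth sandwich leg) give `n⁻⁸·n⁻⁶·n⁶ = n⁻⁸` resp. the spec's `433·n⁵ × n⁻⁵` — the n-free (1.22) rows a rest needs; nothing of that
instance is constructed here.

CONTENT (all [folklore]; every letter a DISPLAYED `∀`-hypothesis, the vertex families centred at `n•y` as in `GhostWordFamilies`):
* §4 **`abs_biBubble_le_of_profiles`** (explicit centres `C, C′`: `≤ |F|²·(Kᵣ(a)κ₁A)·(Kᵣ(b)κ₂A′)·K_{D,a+b}(ε)·n^{2D−(a+b)}·e^{−(ε∕2n)‖C−C′‖∞}`,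
  `Kᵣ(p) = |F|·(2r+1)^D·(r+1)^p·e^{δr}`, `K_{D,p}(ε)` = PART 1 §2's constant) and **`decay510_biBubble_of_profiles`** (the family, coarse rate `ε∕(2D)` in `|·|₁`).
* §5 **`abs_tadpole_le_of_profile`** (one profile leg between the two columns of a bi-local density table `|W y x| ≤ A₂·e^{−(σ∕n)‖y−C‖∞}·e^{−(σ∕n)‖x−C′‖∞}`:
  `≤ |F|²·κ·A₂·K_{D,p}(ε)·n^{2D−p}·e^{−(ε∕2n)‖C−C′‖∞}`, `ε = min σ δ`) and **`decay510_tadpole_of_profile`**.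
NOT HERE (honest): the CRITICAL twin `a + b = D` (the main word's `log n`; needs a damping-centre-free critical kit lemma), the instances (ghost ∕ tt — the
consumers' files: STEP A of GHOST-N8-SPEC with leaf-01's Abel step `ChargeFreeComposition` ∕ OWNER `ColumnGaugeAbel`, β2 ∕ `GluonLegProfile` legs), any (1.22) row.

HONEST DEPENDENCY (cell records, verbatim): «continuum YM on T⁴ ⇐ BetaPertH ∧ nine spine estimates (0/9 proved); BetaPertH ⇐ (D1) ∧ (D4) ∧
CAP+tail; G-an2-4 gates asym, D1 and NE2/3/4.»  HONEST FRAMING (cell contract, verbatim): «discharging `BetaPertH` makes Bałaban's UV stability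
UNCONDITIONAL — a real constructive-QFT result; it is NOT the continuum limit and NOT the Clay problem.»  THIS MODULE DISCHARGES NOTHING of (K), of
D1 or of the wall: [folklore] `ℓ¹`∕lattice-sum bookkeeping over ARBITRARY kernels (an2's `ExpKernelCalculus.comp ∕ tr ∕ tadpole`, leaf-03's
`PackedKernelSplit.biBubble`) with every letter a DISPLAYED `∀`-hypothesis; nothing about Bałaban's operators asserted.  No definition, no `def … : Prop`,
nothing cited, 0 sorry.  0 root-level binders of row D1 discharged (hW ∕ hR-sockets ∕ hSX-socket ∕ D1Tel ∕ D1Rep = 0); (K) NOT closed; NOT D1, NOT `BetaPertH`,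
NOT continuum, NOT Clay.
ABSOLUTE RULE (cell charter, verbatim): «No internally-minted statement may enter as a cited fact. Every hypothesis is either kernel-proved in this
package or a verbatim quotation of a PUBLISHED theorem with page reference. The manuscript(s) under audit are NOT citable for their own disputed
steps — they are the thing under adjudication; programme-internal (2001/route/tribunal) claims are never citable.»
Unit `b2b-balaban-beta-d1-formalise-leaf-04` (gen 25), D1 formalisation swarm leaf prover 04, road «BF-x» (journal [D1LEAF04-G25-INTENT-2]).
-/

noncomputable section

namespace Summit.QuantumFields.BalabanUV.Beta.D1BFx.ProfileWordFamilies


open Finset Real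
open scoped BigOperators
open Literature.Probability.LatticeModels (Site)
open Literature.MathematicalPhysics.QuantumFieldTheory.Balaban1983to89
open Literature.MathematicalPhysics.QuantumFieldTheory.Balaban1983to89.Beta
open B12Sec2to5 (l1 l1_nonneg Decay510)
open ExpKernelCalculus (MKer comp tr tadpole)
open PoissonInterior (cube mem_cube supNorm nrm supNorm_le_iff natAbs_le_supNorm supNorm_add_le supNorm_neg nrm_pos one_le_nrm supNorm_le_nrm
  mem_cube_iff_supNorm)
open Summit.QuantumFields.BalabanUV.Beta.D1BFx.PackedKernelSplit (biBubble)
open Summit.QuantumFields.BalabanUV.Beta.D1BFx.LatticeHLSRadial (sum_pow_mul_exp_scale_le)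
open Summit.QuantumFields.BalabanUV.Beta.D1BFx.BlockPairRieszCount (le_supNorm_zsmul)
open Summit.QuantumFields.BalabanUV.Beta.D1BFx.LatticeHLSProfiles (sum_pow_mul_exp_div_nrm_pow_free_scale_le summable_and_abs_tsum_le_of_abs_sum_le
  summable_and_tsum_le_of_sum_le)

open Summit.QuantumFields.BalabanUV.Beta.D1BFx.ProfileWordCount (sum_sum_damped_riesz_le abs_tr_comp_le_of_majorant abs_comp_le_of_profile_density
  exp_centres_le)

variable {D : ℕ} {F : Type*} [Fintype F]

/-! ## §4 The words -/

section Words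

variable (hD : 0 < D) {n : ℕ} (hn : 1 ≤ n)
  {L₁ L₂ : MKer D F} {κ₁ κ₂ A A' δ σ : ℝ} {a b r : ℕ}
  (hκ₁ : 0 ≤ κ₁) (hκ₂ : 0 ≤ κ₂) (hA : 0 ≤ A) (hA' : 0 ≤ A') (hδ : 0 < δ) (hσ : 0 < σ) (hab : a + b ≤ D - 1)
  (hL₁ : ∀ x y g g', |L₁ x y g g'| ≤ κ₁ / nrm (x - y) ^ a * Real.exp (-(δ / n) * supNorm (x - y)))
  (hL₂ : ∀ x y g g', |L₂ x y g g'| ≤ κ₂ / nrm (x - y) ^ b * Real.exp (-(δ / n) * supNorm (x - y)))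
include hD hn hκ₁ hκ₂ hA hA' hδ hσ hab hL₁ hL₂

/-- [folklore] **THE TWO-LEG BUBBLE FROM PROFILES AND DENSITIES, EXPLICIT CENTRES** (`a + b ≤ D − 1`): with `V` a density vertex at `C` and `V′` one at
`C′` (both of range `r`), `|biBubble L₁ V L₂ V′| ≤ |F|²·(Kᵣ(a)·κ₁·A)·(Kᵣ(b)·κ₂·A′)·K_{D,a+b}(ε)·n^{2D−(a+b)}·e^{−(ε∕2n)‖C−C′‖∞}`, `ε = min σ (2δ)`,
`Kᵣ(p) = |F|·(2r+1)^D·(r+1)^p·e^{δr}`, `K_{D,p}(ε)` = §2's constant. -/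
theorem abs_biBubble_le_of_profiles {V V' : MKer D F} {C C' : Site D}
    (hVb : ∀ y z g f, |V y z g f| ≤ A * Real.exp (-(σ / n) * supNorm (z - C)))
    (hVr : ∀ y z g f, r < supNorm (y - z) → V y z g f = 0)
    (hV'b : ∀ y z g f, |V' y z g f| ≤ A' * Real.exp (-(σ / n) * supNorm (z - C')))
    (hV'r : ∀ y z g f, r < supNorm (y - z) → V' y z g f = 0) :
    |biBubble L₁ V L₂ V'| ≤ (Fintype.card F : ℝ) ^ 2 *
      (((Fintype.card F : ℝ) * (2 * r + 1) ^ D * ((r : ℝ) + 1) ^ a * Real.exp (δ * r) * κ₁ * A)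
        * ((Fintype.card F : ℝ) * (2 * r + 1) ^ D * ((r : ℝ) + 1) ^ b * Real.exp (δ * r) * κ₂ * A')
        * ((2 * (1 + 2 * D * 3 ^ (D - 1) * ((D - 1 - (a + b)).factorial * (8 / min σ (2 * δ)) ^ (D - 1 - (a + b)) * (1 + 8 / min σ (2 * δ)))))
          * (1 + 2 * D * 3 ^ (D - 1) * ((D - 1).factorial * (4 / min σ (2 * δ)) ^ (D - 1) * (1 + 4 / min σ (2 * δ))))
          * (n : ℝ) ^ (2 * D - (a + b)) * Real.exp (-(min σ (2 * δ) / 2 / n) * supNorm (C - C')))) := by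
  have hn0 : (0 : ℝ) < n := by exact_mod_cast hn
  set ε : ℝ := min σ (2 * δ) with hε
  have hε0 : 0 < ε := lt_min hσ (by linarith)
  have hεσ : ε ≤ σ := min_le_left _ _
  have hεδ : ε ≤ 2 * δ := min_le_right _ _
  set K₁ : ℝ := (Fintype.card F : ℝ) * (2 * r + 1) ^ D * ((r : ℝ) + 1) ^ a * Real.exp (δ * r) * κ₁ * A with hK₁
  set K₂ : ℝ := (Fintype.card F : ℝ) * (2 * r + 1) ^ D * ((r : ℝ) + 1) ^ b * Real.exp (δ * r) * κ₂ * A' with hK₂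
  have hK₁0 : 0 ≤ K₁ := by rw [hK₁]; positivity
  have hK₂0 : 0 ≤ K₂ := by rw [hK₂]; positivity
  -- the two composition majorants
  have hM₁ := abs_comp_le_of_profile_density hn hκ₁ hA hδ.le hL₁ hVb hVr
  have hM₂ := abs_comp_le_of_profile_density hn hκ₂ hA' hδ.le hL₂ hV'b hV'r
  unfold PackedKernelSplit.biBubble
  refine le_trans (abs_tr_comp_le_of_majorant
    (M₁ := fun x z => K₁ * (1 / nrm (x - z) ^ a * Real.exp (-(δ / n) * supNorm (x - z)) * Real.exp (-(σ / n) * supNorm (z - C))))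
    (M₂ := fun z x => K₂ * (1 / nrm (z - x) ^ b * Real.exp (-(δ / n) * supNorm (z - x)) * Real.exp (-(σ / n) * supNorm (x - C'))))
    (fun x z g f => by simpa only [hK₁] using hM₁ x z g f) (fun z x f g => by simpa only [hK₂] using hM₂ z x f g)
    (fun x z => by have := nrm_pos (x - z); positivity) (fun z x => by have := nrm_pos (z - x); positivity) fun S T => ?_) (le_of_eq (by rw [hK₁, hK₂, hε]))
  -- the double sum: reduce to §2 at the common rate `ε`
  have hcore := sum_sum_damped_riesz_le hD hε0 hn hab S T C C'
  have hpt : ∀ x z, K₁ * (1 / nrm (x - z) ^ a * Real.exp (-(δ / n) * supNorm (x - z)) * Real.exp (-(σ / n) * supNorm (z - C)))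
        * (K₂ * (1 / nrm (z - x) ^ b * Real.exp (-(δ / n) * supNorm (z - x)) * Real.exp (-(σ / n) * supNorm (x - C'))))
      ≤ K₁ * K₂ * (1 / nrm (x - z) ^ (a + b) * Real.exp (-(ε / n) * supNorm (x - z)) * Real.exp (-(ε / n) * supNorm (z - C))
        * Real.exp (-(ε / n) * supNorm (x - C'))) := by
    intro x z
    have hzx : nrm (z - x) = nrm (x - z) := by rw [show z - x = -(x - z) by abel, PoissonInterior.nrm_neg]
    have hzx' : supNorm (z - x) = supNorm (x - z) := by rw [show z - x = -(x - z) by abel, supNorm_neg]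
    rw [hzx, hzx']
    have hq := nrm_pos (x - z)
    have t0 : (0 : ℝ) ≤ supNorm (x - z) := Nat.cast_nonneg _
    have t1 : (0 : ℝ) ≤ supNorm (z - C) := Nat.cast_nonneg _
    have t2 : (0 : ℝ) ≤ supNorm (x - C') := Nat.cast_nonneg _
    have e1 : Real.exp (-(δ / n) * supNorm (x - z)) * Real.exp (-(δ / n) * supNorm (x - z)) ≤ Real.exp (-(ε / n) * supNorm (x - z)) := by
      rw [← Real.exp_add]; apply Real.exp_le_exp.mpr
      have h' : ε / n * (supNorm (x - z) : ℝ) ≤ 2 * δ / n * (supNorm (x - z) : ℝ) :=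
        mul_le_mul_of_nonneg_right (div_le_div_of_nonneg_right hεδ hn0.le) t0
      have e' : 2 * δ / (n : ℝ) * (supNorm (x - z) : ℝ) = δ / n * supNorm (x - z) + δ / n * supNorm (x - z) := by ring
      linarith
    have e2 : Real.exp (-(σ / n) * supNorm (z - C)) ≤ Real.exp (-(ε / n) * supNorm (z - C)) := by
      apply Real.exp_le_exp.mpr
      have h' : ε / n * (supNorm (z - C) : ℝ) ≤ σ / n * (supNorm (z - C) : ℝ) :=
        mul_le_mul_of_nonneg_right (div_le_div_of_nonneg_right hεσ hn0.le) t1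
      linarith
    have e3 : Real.exp (-(σ / n) * supNorm (x - C')) ≤ Real.exp (-(ε / n) * supNorm (x - C')) := by
      apply Real.exp_le_exp.mpr
      have h' : ε / n * (supNorm (x - C') : ℝ) ≤ σ / n * (supNorm (x - C') : ℝ) :=
        mul_le_mul_of_nonneg_right (div_le_div_of_nonneg_right hεσ hn0.le) t2
      linarith
    have epow : 1 / nrm (x - z) ^ a * (1 / nrm (x - z) ^ b) = 1 / nrm (x - z) ^ (a + b) := by
      rw [pow_add]; field_simp
    calc K₁ * (1 / nrm (x - z) ^ a * Real.exp (-(δ / n) * supNorm (x - z)) * Real.exp (-(σ / n) * supNorm (z - C)))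
          * (K₂ * (1 / nrm (x - z) ^ b * Real.exp (-(δ / n) * supNorm (x - z)) * Real.exp (-(σ / n) * supNorm (x - C'))))
        = K₁ * K₂ * ((1 / nrm (x - z) ^ a * (1 / nrm (x - z) ^ b)) * (Real.exp (-(δ / n) * supNorm (x - z)) * Real.exp (-(δ / n) * supNorm (x - z)))
          * Real.exp (-(σ / n) * supNorm (z - C)) * Real.exp (-(σ / n) * supNorm (x - C'))) := by ring
      _ ≤ K₁ * K₂ * ((1 / nrm (x - z) ^ (a + b)) * Real.exp (-(ε / n) * supNorm (x - z))
          * Real.exp (-(ε / n) * supNorm (z - C)) * Real.exp (-(ε / n) * supNorm (x - C'))) := by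
          rw [epow]; gcongr
  calc ∑ x ∈ S, ∑ z ∈ T, K₁ * (1 / nrm (x - z) ^ a * Real.exp (-(δ / n) * supNorm (x - z)) * Real.exp (-(σ / n) * supNorm (z - C)))
          * (K₂ * (1 / nrm (z - x) ^ b * Real.exp (-(δ / n) * supNorm (z - x)) * Real.exp (-(σ / n) * supNorm (x - C'))))
      ≤ ∑ x ∈ S, ∑ z ∈ T, K₁ * K₂ * (1 / nrm (x - z) ^ (a + b) * Real.exp (-(ε / n) * supNorm (x - z)) * Real.exp (-(ε / n) * supNorm (z - C))
          * Real.exp (-(ε / n) * supNorm (x - C'))) := Finset.sum_le_sum fun x _ => Finset.sum_le_sum fun z _ => hpt x z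
    _ = K₁ * K₂ * ∑ x ∈ S, ∑ z ∈ T, 1 / nrm (x - z) ^ (a + b) * Real.exp (-(ε / n) * supNorm (x - z)) * Real.exp (-(ε / n) * supNorm (z - C))
          * Real.exp (-(ε / n) * supNorm (x - C')) := by
        rw [Finset.mul_sum]; refine Finset.sum_congr rfl fun x _ => ?_; rw [Finset.mul_sum]
    _ ≤ K₁ * K₂ * _ := mul_le_mul_of_nonneg_left hcore (mul_nonneg hK₁0 hK₂0)
    _ = _ := by ring

/-- [folklore] **THE PROFILE WORD-FAMILY LETTER (d1)**: PROFILE legs `|L₁ x y| ≤ κ₁·nrm(x−y)^{−a}·e^{−(δ∕n)‖x−y‖∞}`, `|L₂ x y| ≤ κ₂·nrm(x−y)^{−b}·e^{−(δ∕n)‖x−y‖∞}`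
(`a + b ≤ D − 1`), DENSITY vertex families `|𝒱 μ y p q g f| ≤ A·e^{−(σ∕n)‖q − n•y‖∞}`, `|𝒱′ ν y p q g f| ≤ A′·e^{−(σ∕n)‖q − n•y‖∞}`, both of finite
range `r` (`𝒱 μ y p q = 0` unless `‖p−q‖∞ ≤ r`) ⟹
`Decay510 (z ↦ biBubble L₁ (𝒱 μ 0) L₂ (𝒱′ ν z)) (|F|²·(Kᵣ(a)κ₁A)·(Kᵣ(b)κ₂A′)·K_{D,a+b}(ε)·n^{2D−(a+b)}) (ε∕(2D))`, `ε = min σ (2δ)` — an n-FREE coarse rate.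
READING (`D = 4`): two density vertices after one Abel step each (`A = A′ ≍ n⁻⁴` ghost, `≍ n⁻²·(…)` tt) against one singular and one block-smooth leg
(`a + b = 2`, `κ₁κ₂ ≍ n⁻⁶`) give `n⁻⁸·n⁻⁶·n⁶ = n⁻⁸` — the n-free (1.22) row the tower weight asks of a rest (GHOST-N8-SPEC §1). -/
theorem decay510_biBubble_of_profiles
    {𝒱 𝒱' : Fin D → Site D → MKer D F} (μ ν : Fin D)
    (hVb : ∀ y p q g f, |𝒱 μ y p q g f| ≤ A * Real.exp (-(σ / n) * supNorm (q - (n : ℤ) • y)))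
    (hVr : ∀ y p q g f, r < supNorm (p - q) → 𝒱 μ y p q g f = 0)
    (hV'b : ∀ y p q g f, |𝒱' ν y p q g f| ≤ A' * Real.exp (-(σ / n) * supNorm (q - (n : ℤ) • y)))
    (hV'r : ∀ y p q g f, r < supNorm (p - q) → 𝒱' ν y p q g f = 0) :
    Decay510 (fun z => biBubble L₁ (𝒱 μ 0) L₂ (𝒱' ν z))
      ((Fintype.card F : ℝ) ^ 2 *
        (((Fintype.card F : ℝ) * (2 * r + 1) ^ D * ((r : ℝ) + 1) ^ a * Real.exp (δ * r) * κ₁ * A)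
          * ((Fintype.card F : ℝ) * (2 * r + 1) ^ D * ((r : ℝ) + 1) ^ b * Real.exp (δ * r) * κ₂ * A')
          * ((2 * (1 + 2 * D * 3 ^ (D - 1) * ((D - 1 - (a + b)).factorial * (8 / min σ (2 * δ)) ^ (D - 1 - (a + b)) * (1 + 8 / min σ (2 * δ)))))
            * (1 + 2 * D * 3 ^ (D - 1) * ((D - 1).factorial * (4 / min σ (2 * δ)) ^ (D - 1) * (1 + 4 / min σ (2 * δ))))
            * (n : ℝ) ^ (2 * D - (a + b)))))
      (min σ (2 * δ) / 2 / D) := by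
  intro z
  have h := abs_biBubble_le_of_profiles hD hn hκ₁ hκ₂ hA hA' hδ hσ hab hL₁ hL₂ (hVb 0) (hVr 0) (hV'b z) (hV'r z)
  refine h.trans ?_
  have hε0 : 0 ≤ min σ (2 * δ) / 2 := by have := lt_min hσ (by linarith : (0:ℝ) < 2 * δ); linarith
  have hc := exp_centres_le hD hn hε0 z
  have e1 : -(min σ (2 * δ) / 2 / (n : ℝ)) = -(min σ (2 * δ) / 2 / n) := rfl
  have hK : 0 ≤ (Fintype.card F : ℝ) ^ 2 *
        (((Fintype.card F : ℝ) * (2 * r + 1) ^ D * ((r : ℝ) + 1) ^ a * Real.exp (δ * r) * κ₁ * A)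
          * ((Fintype.card F : ℝ) * (2 * r + 1) ^ D * ((r : ℝ) + 1) ^ b * Real.exp (δ * r) * κ₂ * A')
          * ((2 * (1 + 2 * D * 3 ^ (D - 1) * ((D - 1 - (a + b)).factorial * (8 / min σ (2 * δ)) ^ (D - 1 - (a + b)) * (1 + 8 / min σ (2 * δ)))))
            * (1 + 2 * D * 3 ^ (D - 1) * ((D - 1).factorial * (4 / min σ (2 * δ)) ^ (D - 1) * (1 + 4 / min σ (2 * δ))))
            * (n : ℝ) ^ (2 * D - (a + b)))) := by
    have : 0 < min σ (2 * δ) := lt_min hσ (by linarith)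
    positivity
  calc _ = (Fintype.card F : ℝ) ^ 2 *
        (((Fintype.card F : ℝ) * (2 * r + 1) ^ D * ((r : ℝ) + 1) ^ a * Real.exp (δ * r) * κ₁ * A)
          * ((Fintype.card F : ℝ) * (2 * r + 1) ^ D * ((r : ℝ) + 1) ^ b * Real.exp (δ * r) * κ₂ * A')
          * ((2 * (1 + 2 * D * 3 ^ (D - 1) * ((D - 1 - (a + b)).factorial * (8 / min σ (2 * δ)) ^ (D - 1 - (a + b)) * (1 + 8 / min σ (2 * δ)))))
            * (1 + 2 * D * 3 ^ (D - 1) * ((D - 1).factorial * (4 / min σ (2 * δ)) ^ (D - 1) * (1 + 4 / min σ (2 * δ))))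
            * (n : ℝ) ^ (2 * D - (a + b)))) * Real.exp (-(min σ (2 * δ) / 2 / n) * supNorm ((n : ℤ) • (0 : Site D) - (n : ℤ) • z)) := by ring
    _ ≤ _ := mul_le_mul_of_nonneg_left hc hK

end Words

/-! ## §5 The tadpole word: one profile leg between the two columns of a bi-local table -/

section Tadpole

variable (hD : 0 < D) {n : ℕ} (hn : 1 ≤ n) {L : MKer D F} {κ A₂ δ σ : ℝ} {p : ℕ}
  (hκ : 0 ≤ κ) (hA₂ : 0 ≤ A₂) (hδ : 0 < δ) (hσ : 0 < σ) (hp : p ≤ D - 1)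
  (hL : ∀ x y g g', |L x y g g'| ≤ κ / nrm (x - y) ^ p * Real.exp (-(δ / n) * supNorm (x - y)))
include hD hn hκ hA₂ hδ hσ hp hL

/-- [folklore] **THE TADPOLE FROM ONE PROFILE LEG AND A BI-LOCAL DENSITY TABLE, EXPLICIT CENTRES**: `|W y x g a| ≤ A₂·e^{−(σ∕n)‖y−C‖∞}·e^{−(σ∕n)‖x−C′‖∞}`
⟹ `|tadpole L W| ≤ |F|²·κ·A₂·K_{D,p}(ε)·n^{2D−p}·e^{−(ε∕2n)‖C−C′‖∞}`, `ε = min σ δ`. -/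
theorem abs_tadpole_le_of_profile {W : MKer D F} {C C' : Site D}
    (hW : ∀ y x g a, |W y x g a| ≤ A₂ * Real.exp (-(σ / n) * supNorm (y - C)) * Real.exp (-(σ / n) * supNorm (x - C'))) :
    |tadpole L W| ≤ (Fintype.card F : ℝ) ^ 2 * (κ * A₂ *
      ((2 * (1 + 2 * D * 3 ^ (D - 1) * ((D - 1 - p).factorial * (8 / min σ δ) ^ (D - 1 - p) * (1 + 8 / min σ δ))))
        * (1 + 2 * D * 3 ^ (D - 1) * ((D - 1).factorial * (4 / min σ δ) ^ (D - 1) * (1 + 4 / min σ δ)))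
        * (n : ℝ) ^ (2 * D - p) * Real.exp (-(min σ δ / 2 / n) * supNorm (C - C')))) := by
  have hn0 : (0 : ℝ) < n := by exact_mod_cast hn
  set ε : ℝ := min σ δ with hε
  have hε0 : 0 < ε := lt_min hσ hδ
  have hεσ : ε ≤ σ := min_le_left _ _
  have hεδ : ε ≤ δ := min_le_right _ _
  unfold ExpKernelCalculus.tadpole
  refine le_trans (abs_tr_comp_le_of_majorant
    (M₁ := fun x y => κ / nrm (x - y) ^ p * Real.exp (-(δ / n) * supNorm (x - y)))
    (M₂ := fun y x => A₂ * Real.exp (-(σ / n) * supNorm (y - C)) * Real.exp (-(σ / n) * supNorm (x - C')))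
    (fun x y g g' => hL x y g g') (fun y x g g' => hW y x g g')
    (fun x y => by have := nrm_pos (x - y); positivity) (fun y x => by positivity) fun S T => ?_) (le_of_eq (by rw [hε]))
  have hcore := sum_sum_damped_riesz_le hD hε0 hn hp S T C C'
  have hpt : ∀ x y, κ / nrm (x - y) ^ p * Real.exp (-(δ / n) * supNorm (x - y))
        * (A₂ * Real.exp (-(σ / n) * supNorm (y - C)) * Real.exp (-(σ / n) * supNorm (x - C')))
      ≤ κ * A₂ * (1 / nrm (x - y) ^ p * Real.exp (-(ε / n) * supNorm (x - y)) * Real.exp (-(ε / n) * supNorm (y - C))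
        * Real.exp (-(ε / n) * supNorm (x - C'))) := by
    intro x y
    have hq := nrm_pos (x - y)
    have t0 : (0 : ℝ) ≤ supNorm (x - y) := Nat.cast_nonneg _
    have t1 : (0 : ℝ) ≤ supNorm (y - C) := Nat.cast_nonneg _
    have t2 : (0 : ℝ) ≤ supNorm (x - C') := Nat.cast_nonneg _
    have e1 : Real.exp (-(δ / n) * supNorm (x - y)) ≤ Real.exp (-(ε / n) * supNorm (x - y)) := by
      apply Real.exp_le_exp.mpr
      have h' := mul_le_mul_of_nonneg_right (div_le_div_of_nonneg_right hεδ hn0.le) t0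
      linarith
    have e2 : Real.exp (-(σ / n) * supNorm (y - C)) ≤ Real.exp (-(ε / n) * supNorm (y - C)) := by
      apply Real.exp_le_exp.mpr
      have h' := mul_le_mul_of_nonneg_right (div_le_div_of_nonneg_right hεσ hn0.le) t1
      linarith
    have e3 : Real.exp (-(σ / n) * supNorm (x - C')) ≤ Real.exp (-(ε / n) * supNorm (x - C')) := by
      apply Real.exp_le_exp.mpr
      have h' := mul_le_mul_of_nonneg_right (div_le_div_of_nonneg_right hεσ hn0.le) t2
      linarith
    calc κ / nrm (x - y) ^ p * Real.exp (-(δ / n) * supNorm (x - y))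
          * (A₂ * Real.exp (-(σ / n) * supNorm (y - C)) * Real.exp (-(σ / n) * supNorm (x - C')))
        = κ * A₂ * (1 / nrm (x - y) ^ p * Real.exp (-(δ / n) * supNorm (x - y)) * Real.exp (-(σ / n) * supNorm (y - C))
          * Real.exp (-(σ / n) * supNorm (x - C'))) := by ring
      _ ≤ κ * A₂ * (1 / nrm (x - y) ^ p * Real.exp (-(ε / n) * supNorm (x - y)) * Real.exp (-(ε / n) * supNorm (y - C))
          * Real.exp (-(ε / n) * supNorm (x - C'))) := by gcongr
  calc ∑ x ∈ S, ∑ y ∈ T, κ / nrm (x - y) ^ p * Real.exp (-(δ / n) * supNorm (x - y))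
          * (A₂ * Real.exp (-(σ / n) * supNorm (y - C)) * Real.exp (-(σ / n) * supNorm (x - C')))
      ≤ ∑ x ∈ S, ∑ y ∈ T, κ * A₂ * (1 / nrm (x - y) ^ p * Real.exp (-(ε / n) * supNorm (x - y)) * Real.exp (-(ε / n) * supNorm (y - C))
          * Real.exp (-(ε / n) * supNorm (x - C'))) := Finset.sum_le_sum fun x _ => Finset.sum_le_sum fun y _ => hpt x y
    _ = κ * A₂ * ∑ x ∈ S, ∑ y ∈ T, 1 / nrm (x - y) ^ p * Real.exp (-(ε / n) * supNorm (x - y)) * Real.exp (-(ε / n) * supNorm (y - C))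
          * Real.exp (-(ε / n) * supNorm (x - C')) := by
        rw [Finset.mul_sum]; refine Finset.sum_congr rfl fun x _ => ?_; rw [Finset.mul_sum]
    _ ≤ κ * A₂ * _ := mul_le_mul_of_nonneg_left hcore (mul_nonneg hκ hA₂)
    _ = _ := by ring

/-- [folklore] **THE TADPOLE FAMILY FROM ONE PROFILE LEG AND A BI-LOCAL DENSITY TABLE FAMILY**: `|𝒲 μ y ν y′ q x g a| ≤ A₂·e^{−(σ∕n)‖q − n•y‖∞}·e^{−(σ∕n)‖x − n•y′‖∞}`
⟹ `Decay510 (z ↦ tadpole L (𝒲 μ 0 ν z)) (|F|²·κ·A₂·K_{D,p}(ε)·n^{2D−p}) (ε∕(2D))`, `ε = min σ δ`. -/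
theorem decay510_tadpole_of_profile {𝒲 : Fin D → Site D → Fin D → Site D → MKer D F} (μ ν : Fin D)
    (hW : ∀ y y' q x g a, |𝒲 μ y ν y' q x g a|
      ≤ A₂ * Real.exp (-(σ / n) * supNorm (q - (n : ℤ) • y)) * Real.exp (-(σ / n) * supNorm (x - (n : ℤ) • y'))) :
    Decay510 (fun z => tadpole L (𝒲 μ 0 ν z))
      ((Fintype.card F : ℝ) ^ 2 * (κ * A₂ *
        ((2 * (1 + 2 * D * 3 ^ (D - 1) * ((D - 1 - p).factorial * (8 / min σ δ) ^ (D - 1 - p) * (1 + 8 / min σ δ))))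
          * (1 + 2 * D * 3 ^ (D - 1) * ((D - 1).factorial * (4 / min σ δ) ^ (D - 1) * (1 + 4 / min σ δ)))
          * (n : ℝ) ^ (2 * D - p))))
      (min σ δ / 2 / D) := by
  intro z
  have h := abs_tadpole_le_of_profile hD hn hκ hA₂ hδ hσ hp hL (hW 0 z)
  refine h.trans ?_
  have hε0 : 0 ≤ min σ δ / 2 := by have := lt_min hσ hδ; linarith
  have hc := exp_centres_le hD hn hε0 z
  have hK : 0 ≤ (Fintype.card F : ℝ) ^ 2 * (κ * A₂ *
        ((2 * (1 + 2 * D * 3 ^ (D - 1) * ((D - 1 - p).factorial * (8 / min σ δ) ^ (D - 1 - p) * (1 + 8 / min σ δ))))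
          * (1 + 2 * D * 3 ^ (D - 1) * ((D - 1).factorial * (4 / min σ δ) ^ (D - 1) * (1 + 4 / min σ δ)))
          * (n : ℝ) ^ (2 * D - p))) := by
    have : 0 < min σ δ := lt_min hσ hδ
    positivity
  calc _ = (Fintype.card F : ℝ) ^ 2 * (κ * A₂ *
        ((2 * (1 + 2 * D * 3 ^ (D - 1) * ((D - 1 - p).factorial * (8 / min σ δ) ^ (D - 1 - p) * (1 + 8 / min σ δ))))
          * (1 + 2 * D * 3 ^ (D - 1) * ((D - 1).factorial * (4 / min σ δ) ^ (D - 1) * (1 + 4 / min σ δ)))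
          * (n : ℝ) ^ (2 * D - p))) * Real.exp (-(min σ δ / 2 / n) * supNorm ((n : ℤ) • (0 : Site D) - (n : ℤ) • z)) := by ring
    _ ≤ _ := mul_le_mul_of_nonneg_left hc hK

end Tadpole


end Summit.QuantumFields.BalabanUV.Beta.D1BFx.ProfileWordFamilies

end
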